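import Summits.CriticalPhenomena.Ising3DConformalLimit.Theses.HyperoctahedralRP
import Summits.CriticalPhenomena.Ising3DConformalLimit.Theses.CurrentConnectionInvariance
import Summits.CriticalPhenomena.Ising3DConformalLimit.Theorems.HyperoctahedralRPInversionUpgradeNormalised
import Summits.CriticalPhenomena.Ising3DConformalLimit.Theorems.HyperoctahedralRPInversionUpgradeNormalisedEvenPos
import Summits.CriticalPhenomena.Ising3DConformalLimit.Theorems.HyperoctahedralRPInversionUpgradeNormalisedRatioTransfer
import Summits.CriticalPhenomena.Ising3DConformalLimit.Theorems.InversionUpgradeNormalised.Negative.LoadBearingHypotheses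
import HarnessLib

/-!
# `InversionUpgradeNormalised` (stmt-CriticalPhenomena-1982): the two open stubs suffice, and
# `RatioInversionInvariance` (stmt-CriticalPhenomena-4840) implies the crux — CONDITIONAL results

Route `HyperoctahedralRP`, sub-problem `Ising3DConformalLimit`, line `inversion-defect-involution`
(lead `prover-line-stmt-CriticalPhenomena-1982-0`).  Companion of
`HyperoctahedralRPInversionUpgradeNormalised.lean` (squeeze, reduction, composition of the four
registered stubs).  Here the two LANDED stubs are discharged —
A = `stub_evenPos` (`…EvenPos.lean`, p71996: even orders of the limit are positive, GKS II in the
limit) and B = `stub_ratioTransfer` (`…RatioTransfer.lean`, p71926: eventual lattice ratio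
inequalities pass to the limit ratios) — leaving the crux as a consequence of the two OPEN stubs
C = `stub_latticeFour`, D = `stub_latticeHigher` alone (`InversionUpgradeNormalised_of_latticeOneSided`),
and the CROSS-ROUTE BRIDGE is drawn: C and D are the one-sided, ball-restricted halves of route
`CurrentConnectionInvariance`'s crux `RatioInversionInvariance` (item stmt-CriticalPhenomena-4840:
the weight-free lattice ratios `R^δ_n = G_n G_2 / G_{n+2}` of `criticalCorr 3` — `a ↔ b` connection
probabilities of sourced double random currents, Aizenman–Duminil-Copin, Ann. Math. 194 (2021),
§3.2 — satisfy `R^δ_n(ιx) − R^δ_n(x) → 0` as `δ → 0⁺`), hence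
**`InversionUpgradeNormalised_of_ratioInversionInvariance : RatioInversionInvariance → InversionUpgradeNormalised`**
(stmt-4840 ⇒ stmt-1982); ZERO SLACK is recorded: the crux gives C ∧ D back
(`InversionUpgradeNormalised_iff_latticeOneSided`); and the CONVERSE BRIDGE
`ratioInversionInvariance_of_InversionUpgradeNormalised`: given the Euclidean-limit conjecture
`CritIsing3DEuclideanLimit`, 1982 ⇒ 4840 — so the two routes' cruxes are EQUIVALENT modulo 0638.  The bridge is a CONDITIONAL result: 4840 is open and enters only as an explicit
hypothesis; item 1982 is NOT closed by this file.  No definitions.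
-/

noncomputable section

open Filter Topology
open Literature.Probability.LatticeModels EuclideanGeometry
open Summit.CriticalPhenomena.Ising3DConformalLimit.InversionUpgradeNormalisedNegative

namespace Summit.CriticalPhenomena.Ising3DConformalLimit.Cruxes.InversionUpgradeNormalised.InversionDefectInvolution

/-- **The crux from the two OPEN stubs alone.**  With A (`stub_evenPos`) and B (`stub_ratioTransfer`)
landed, `InversionUpgradeNormalised` follows from the registered stubs C (`stub_latticeFour`) and
D (`stub_latticeHigher`) of line `inversion-defect-involution`, stated VERBATIM as hypotheses: for
the crux's data and `x` non-coincident in the punctured open unit ball, eventually as `δ → 0⁺`,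
`R^δ_n(x) ≤ R^δ_n(ιx) + ε` for the weight-free ratios of `criticalCorr 3` at `4` resp. even `≥ 6`
sources.  Both hypotheses are open (they are the `n ≥ 4` Möbius covariance of the Ising₃ limit in
lattice form; every model-blind surrogate is refuted, `Negative/ReflectionMonotone.lean`,
`Negative/SixPointWitness.lean`). [folklore] -/
theorem InversionUpgradeNormalised_of_latticeOneSided
    (hC : ∀ (ρ : ℝ → ℝ) (Δ : ℝ) (S : CorrFamily 3), (∀ δ ∈ Set.Ioc (0:ℝ) 1, 0 < ρ δ) →
      HasPointwiseScalingLimit (criticalCorr 3) ρ S →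
      (∀ n z, z ∉ NonCoincident 3 n → S n z = 0) → IsNondegenerateTwoPoint S →
      IsEuclideanInvariant S → IsScaleCovariant Δ S →
      ∀ x : Fin (2 + 2) → EuclideanSpace ℝ (Fin 3), x ∈ NonCoincident 3 (2 + 2) →
        (∀ i, x i ≠ 0) → (∀ i, ‖x i‖ < 1) →
        ∀ ε : ℝ, 0 < ε → ∀ᶠ δ in 𝓝[>] (0:ℝ),
          criticalCorr 3 2 (fun i => latticeApprox δ (x (Fin.castAdd 2 i))) *
              criticalCorr 3 2 (fun i => latticeApprox δ (x (Fin.natAdd 2 i))) /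
            criticalCorr 3 (2 + 2) (fun i => latticeApprox δ (x i)) ≤
          criticalCorr 3 2 (fun i => latticeApprox δ (inversion 0 1 (x (Fin.castAdd 2 i)))) *
              criticalCorr 3 2 (fun i => latticeApprox δ (inversion 0 1 (x (Fin.natAdd 2 i)))) /
            criticalCorr 3 (2 + 2) (fun i => latticeApprox δ (inversion 0 1 (x i))) + ε)
    (hD : ∀ (ρ : ℝ → ℝ) (Δ : ℝ) (S : CorrFamily 3), (∀ δ ∈ Set.Ioc (0:ℝ) 1, 0 < ρ δ) →
      HasPointwiseScalingLimit (criticalCorr 3) ρ S →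
      (∀ n z, z ∉ NonCoincident 3 n → S n z = 0) → IsNondegenerateTwoPoint S →
      IsEuclideanInvariant S → IsScaleCovariant Δ S →
      ∀ n : ℕ, Even n → 4 ≤ n →
        ∀ x : Fin (n + 2) → EuclideanSpace ℝ (Fin 3), x ∈ NonCoincident 3 (n + 2) →
          (∀ i, x i ≠ 0) → (∀ i, ‖x i‖ < 1) →
          ∀ ε : ℝ, 0 < ε → ∀ᶠ δ in 𝓝[>] (0:ℝ),
          criticalCorr 3 n (fun i => latticeApprox δ (x (Fin.castAdd 2 i))) *
              criticalCorr 3 2 (fun i => latticeApprox δ (x (Fin.natAdd n i))) /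
            criticalCorr 3 (n + 2) (fun i => latticeApprox δ (x i)) ≤
          criticalCorr 3 n (fun i => latticeApprox δ (inversion 0 1 (x (Fin.castAdd 2 i)))) *
              criticalCorr 3 2 (fun i => latticeApprox δ (inversion 0 1 (x (Fin.natAdd n i)))) /
            criticalCorr 3 (n + 2) (fun i => latticeApprox δ (inversion 0 1 (x i))) + ε) :
    Summit.CriticalPhenomena.Ising3DConformalLimit.Theses.HyperoctahedralRP.InversionUpgradeNormalised :=
  InversionUpgradeNormalised_of_stubs stub_evenPos stub_ratioTransfer hC hD

/-! ### The cross-route bridge: `RatioInversionInvariance` (stmt-4840) ⇒ the crux (stmt-1982) -/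

/-- With the trivial renormalisation `ρ ≡ 1` the rescaled correlator IS the lattice correlator at
the lattice approximation: `rescaledCorrelator G 1 m δ z = G m (i ↦ [zᵢ/δ])` (`1 ^ m · a = a`).
[folklore] -/
theorem rescaledCorrelator_one (m : ℕ) (δ : ℝ) (z : Fin m → EuclideanSpace ℝ (Fin 3)) :
    rescaledCorrelator (criticalCorr 3) 1 m δ z =
      criticalCorr 3 m (fun i => latticeApprox δ (z i)) := by
  rw [rescaledCorrelator_apply, Pi.one_apply, one_pow, one_mul]

/-- Filter glue: if `g − f → 0` along `l`, then for every `ε > 0`, eventually `f ≤ g + ε`.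
[folklore] -/
theorem eventually_le_add_of_tendsto_sub_nhds_zero {l : Filter ℝ} (f g : ℝ → ℝ)
    (h : Tendsto (fun δ => g δ - f δ) l (𝓝 0)) {ε : ℝ} (hε : 0 < ε) :
    ∀ᶠ δ in l, f δ ≤ g δ + ε := by
  rw [Metric.tendsto_nhds] at h
  refine (h ε hε).mono fun δ hδ => ?_
  simp only [Real.dist_eq, sub_zero, abs_sub_lt_iff] at hδ
  linarith [hδ.2]

/-- **The bridge at a general even order `n ≥ 2`.** `RatioInversionInvariance` (item
stmt-CriticalPhenomena-4840 of route `CurrentConnectionInvariance`: `R^δ_n(ιx) − R^δ_n(x) → 0` as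
`δ → 0⁺`, ratios written with `rescaledCorrelator (criticalCorr 3) 1`) gives, for every
non-coincident `x` avoiding `0` and every `ε > 0`, eventually `R^δ_n(x) ≤ R^δ_n(ιx) + ε`, with the
ratios written directly with `criticalCorr 3` and `latticeApprox` (the registered, definition-free
spelling of the line's stubs C and D).  (Worker D of the line, adapted.) [folklore] -/
theorem eventually_le_add_of_ratioInversionInvariance
    (h : Summit.CriticalPhenomena.Ising3DConformalLimit.Theses.CurrentConnectionInvariance.RatioInversionInvariance)
    (n : ℕ) (hn : Even n) (h2 : 2 ≤ n)
    (x : Fin (n + 2) → EuclideanSpace ℝ (Fin 3)) (hx : x ∈ NonCoincident 3 (n + 2))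
    (hx0 : ∀ i, x i ≠ 0) (ε : ℝ) (hε : 0 < ε) :
    ∀ᶠ δ in 𝓝[>] (0:ℝ),
      criticalCorr 3 n (fun i => latticeApprox δ (x (Fin.castAdd 2 i))) *
            criticalCorr 3 2 (fun i => latticeApprox δ (x (Fin.natAdd n i))) /
          criticalCorr 3 (n + 2) (fun i => latticeApprox δ (x i)) ≤
        criticalCorr 3 n (fun i => latticeApprox δ (inversion 0 1 (x (Fin.castAdd 2 i)))) *
            criticalCorr 3 2 (fun i => latticeApprox δ (inversion 0 1 (x (Fin.natAdd n i)))) /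
          criticalCorr 3 (n + 2) (fun i => latticeApprox δ (inversion 0 1 (x i))) + ε := by
  have ht := h n hn h2 x hx hx0
  simp only [rescaledCorrelator_one] at ht
  exact eventually_le_add_of_tendsto_sub_nhds_zero _ _ ht hε

/-- **CONDITIONAL RESULT — crux stmt-CriticalPhenomena-4840 implies crux stmt-CriticalPhenomena-1982.**
If the weight-free lattice ratios of the critical Ising₃ correlators are asymptotically inversion
invariant (`RatioInversionInvariance`, route `CurrentConnectionInvariance`, OPEN — an explicit
hypothesis here, which makes this theorem CONDITIONAL and does not close item 1982), then every
normalised, non-degenerate, Euclidean-invariant, scale-covariant pointwise scaling limit of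
`criticalCorr 3` is inversion covariant: 4840 supplies the hypotheses C and D of
`InversionUpgradeNormalised_of_latticeOneSided` (their one-sided halves, by
`eventually_le_add_of_ratioInversionInvariance` at `n = 2` and at even `n ≥ 4`). [folklore] -/
theorem InversionUpgradeNormalised_of_ratioInversionInvariance
    (h : Summit.CriticalPhenomena.Ising3DConformalLimit.Theses.CurrentConnectionInvariance.RatioInversionInvariance) :
    Summit.CriticalPhenomena.Ising3DConformalLimit.Theses.HyperoctahedralRP.InversionUpgradeNormalised := by
  refine InversionUpgradeNormalised_of_latticeOneSided ?_ ?_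
  · intro _ρ _Δ _S _hρ _hlim _hnorm _hnd _heuc _hsc x hx hx0 _hball ε hε
    exact eventually_le_add_of_ratioInversionInvariance h 2 even_two le_rfl x hx hx0 ε hε
  · intro _ρ _Δ _S _hρ _hlim _hnorm _hnd _heuc _hsc n hn h4 x hx hx0 _hball ε hε
    exact eventually_le_add_of_ratioInversionInvariance h n hn (le_trans (by norm_num) h4) x hx hx0 ε hε


/-! ### Zero slack: the crux implies the two open stubs back (C ∧ D ⇔ crux) -/

/-- **Necessity: inversion covariance of the limit forces asymptotic inversion INVARIANCE of
the lattice ratios.**  If a pointwise scaling limit `S` of `criticalCorr 3` (renormalisation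
`ρ > 0` on `(0,1]`, non-degenerate two-point function) is inversion covariant with weight `Δ`,
then at every even order `n` and every non-coincident configuration `x` of `n + 2` points
avoiding `0`, `R^δ_n(ιx) − R^δ_n(x) → 0` as `δ → 0⁺` for the weight-free lattice ratios: both
converge (`tendsto_latticeRatio`, denominators `≠ 0` by `stub_evenPos`) and the limit ratio is
`ι`-invariant because the Kelvin weights `∏‖xᵢ‖^{2Δ}` multiply up (`Fin.prod_univ_add`).
[folklore] -/
theorem tendsto_ratio_sub_of_isInversionCovariant {ρ : ℝ → ℝ} {Δ : ℝ} {S : CorrFamily 3}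
    (hρ : ∀ δ ∈ Set.Ioc (0:ℝ) 1, 0 < ρ δ) (hlim : HasPointwiseScalingLimit (criticalCorr 3) ρ S)
    (hnd : IsNondegenerateTwoPoint S) (hinv : IsInversionCovariant Δ S)
    {n : ℕ} (hn : Even n) {x : Fin (n + 2) → EuclideanSpace ℝ (Fin 3)}
    (hx : x ∈ NonCoincident 3 (n + 2)) (hx0 : ∀ i, x i ≠ 0) :
    Tendsto (fun δ : ℝ =>
        criticalCorr 3 n (fun i => latticeApprox δ (inversion 0 1 (x (Fin.castAdd 2 i)))) *
              criticalCorr 3 2 (fun i => latticeApprox δ (inversion 0 1 (x (Fin.natAdd n i)))) /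
            criticalCorr 3 (n + 2) (fun i => latticeApprox δ (inversion 0 1 (x i))) -
          criticalCorr 3 n (fun i => latticeApprox δ (x (Fin.castAdd 2 i))) *
              criticalCorr 3 2 (fun i => latticeApprox δ (x (Fin.natAdd n i))) /
            criticalCorr 3 (n + 2) (fun i => latticeApprox δ (x i)))
      (𝓝[>] (0:ℝ)) (𝓝 0) := by
  have hpos := stub_evenPos ρ S hρ hlim hnd
  have hn2 : Even (n + 2) := by simpa [Nat.even_add] using hn
  have hιx : (fun i => inversion (0 : EuclideanSpace ℝ (Fin 3)) 1 (x i)) ∈ NonCoincident 3 (n + 2) :=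
    injective_inv_comp hx
  have hSx : S (n + 2) x ≠ 0 := (hpos _ hn2 x hx).ne'
  have hSιx : S (n + 2) (fun i => inversion 0 1 (x i)) ≠ 0 := (hpos _ hn2 _ hιx).ne'
  have h1 := tendsto_latticeRatio hρ hlim hx hSx
  have h2 := tendsto_latticeRatio hρ hlim hιx hSιx
  have key : S n (fun i => inversion 0 1 (x (Fin.castAdd 2 i))) *
        S 2 (fun i => inversion 0 1 (x (Fin.natAdd n i))) / S (n + 2) (fun i => inversion 0 1 (x i)) =
      S n (fun i => x (Fin.castAdd 2 i)) * S 2 (fun i => x (Fin.natAdd n i)) / S (n + 2) x := by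
    have e1 := hinv n (fun i => x (Fin.castAdd 2 i)) (fun i => hx0 _)
    have e2 := hinv 2 (fun i => x (Fin.natAdd n i)) (fun i => hx0 _)
    have e3 := hinv (n + 2) x hx0
    have hw' : 0 < ∏ i : Fin n, ‖x (Fin.castAdd 2 i)‖ ^ (2 * Δ) :=
      Finset.prod_pos fun i _ => Real.rpow_pos_of_pos (norm_pos_iff.mpr (hx0 _)) _
    have hw'' : 0 < ∏ i : Fin 2, ‖x (Fin.natAdd n i)‖ ^ (2 * Δ) :=
      Finset.prod_pos fun i _ => Real.rpow_pos_of_pos (norm_pos_iff.mpr (hx0 _)) _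
    rw [e1, e2, e3, Fin.prod_univ_add, mul_mul_mul_comm,
      mul_div_mul_left _ _ (mul_pos hw' hw'').ne']
  have h3 := h2.sub h1
  rwa [key, sub_self] at h3

/-- One-sided form of the necessity: eventually `R^δ_n(x) ≤ R^δ_n(ιx) + ε`.  So the open stubs C, D
are not WEAKER than the crux: zero slack. [folklore] -/
theorem eventually_le_add_of_isInversionCovariant {ρ : ℝ → ℝ} {Δ : ℝ} {S : CorrFamily 3}
    (hρ : ∀ δ ∈ Set.Ioc (0:ℝ) 1, 0 < ρ δ) (hlim : HasPointwiseScalingLimit (criticalCorr 3) ρ S)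
    (hnd : IsNondegenerateTwoPoint S) (hinv : IsInversionCovariant Δ S)
    {n : ℕ} (hn : Even n) {x : Fin (n + 2) → EuclideanSpace ℝ (Fin 3)}
    (hx : x ∈ NonCoincident 3 (n + 2)) (hx0 : ∀ i, x i ≠ 0) {ε : ℝ} (hε : 0 < ε) :
    ∀ᶠ δ in 𝓝[>] (0:ℝ),
      criticalCorr 3 n (fun i => latticeApprox δ (x (Fin.castAdd 2 i))) *
            criticalCorr 3 2 (fun i => latticeApprox δ (x (Fin.natAdd n i))) /
          criticalCorr 3 (n + 2) (fun i => latticeApprox δ (x i)) ≤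
        criticalCorr 3 n (fun i => latticeApprox δ (inversion 0 1 (x (Fin.castAdd 2 i)))) *
            criticalCorr 3 2 (fun i => latticeApprox δ (inversion 0 1 (x (Fin.natAdd n i)))) /
          criticalCorr 3 (n + 2) (fun i => latticeApprox δ (inversion 0 1 (x i))) + ε :=
  eventually_le_add_of_tendsto_sub_nhds_zero _ _
    (tendsto_ratio_sub_of_isInversionCovariant hρ hlim hnd hinv hn hx hx0) hε

/-- **The converse bridge: crux stmt-1982 ⇒ crux stmt-4840, given the Euclidean limit.**  Under the
Euclidean scaling-limit conjecture `CritIsing3DEuclideanLimit` (item 0638; it supplies an instance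
of all six hypotheses of the crux after normalisation, `exists_hyp_of_euclideanLimit`),
`InversionUpgradeNormalised` implies `RatioInversionInvariance`.  Together with
`InversionUpgradeNormalised_of_ratioInversionInvariance`: the cruxes of routes `HyperoctahedralRP`
(1982) and `CurrentConnectionInvariance` (4840) are EQUIVALENT modulo `CritIsing3DEuclideanLimit`.
CONDITIONAL (both hypotheses open). [folklore] -/
theorem ratioInversionInvariance_of_InversionUpgradeNormalised (hE : CritIsing3DEuclideanLimit)
    (hcrux : Summit.CriticalPhenomena.Ising3DConformalLimit.Theses.HyperoctahedralRP.InversionUpgradeNormalised) :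
    Summit.CriticalPhenomena.Ising3DConformalLimit.Theses.CurrentConnectionInvariance.RatioInversionInvariance := by
  obtain ⟨ρ, Δ, S, hρ, hlim, hnorm, hnd, heuc, hsc⟩ := exists_hyp_of_euclideanLimit hE
  intro n hn _ x hx hx0
  simp only [rescaledCorrelator_one]
  exact tendsto_ratio_sub_of_isInversionCovariant hρ hlim hnd (hcrux ρ Δ S hρ hlim hnorm hnd heuc hsc)
    hn hx hx0

/-- **Zero slack, stated on the registered stubs: the crux implies C ∧ D.**  Conversely to
`InversionUpgradeNormalised_of_latticeOneSided`, `InversionUpgradeNormalised` gives back the two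
open stubs `stub_latticeFour` (C) and `stub_latticeHigher` (D) verbatim (even without the ball
restriction).  Hence C ∧ D ⇔ the crux: the line's reduction loses nothing and gains no slack — any
proof of C is a proof of the `n = 4` Möbius covariance of the Ising₃ limit. [folklore] -/
theorem latticeOneSided_of_InversionUpgradeNormalised
    (hcrux : Summit.CriticalPhenomena.Ising3DConformalLimit.Theses.HyperoctahedralRP.InversionUpgradeNormalised) :
    (∀ (ρ : ℝ → ℝ) (Δ : ℝ) (S : CorrFamily 3), (∀ δ ∈ Set.Ioc (0:ℝ) 1, 0 < ρ δ) →
      HasPointwiseScalingLimit (criticalCorr 3) ρ S →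
      (∀ n z, z ∉ NonCoincident 3 n → S n z = 0) → IsNondegenerateTwoPoint S →
      IsEuclideanInvariant S → IsScaleCovariant Δ S →
      ∀ x : Fin (2 + 2) → EuclideanSpace ℝ (Fin 3), x ∈ NonCoincident 3 (2 + 2) →
        (∀ i, x i ≠ 0) → (∀ i, ‖x i‖ < 1) →
        ∀ ε : ℝ, 0 < ε → ∀ᶠ δ in 𝓝[>] (0:ℝ),
          criticalCorr 3 2 (fun i => latticeApprox δ (x (Fin.castAdd 2 i))) *
              criticalCorr 3 2 (fun i => latticeApprox δ (x (Fin.natAdd 2 i))) /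
            criticalCorr 3 (2 + 2) (fun i => latticeApprox δ (x i)) ≤
          criticalCorr 3 2 (fun i => latticeApprox δ (inversion 0 1 (x (Fin.castAdd 2 i)))) *
              criticalCorr 3 2 (fun i => latticeApprox δ (inversion 0 1 (x (Fin.natAdd 2 i)))) /
            criticalCorr 3 (2 + 2) (fun i => latticeApprox δ (inversion 0 1 (x i))) + ε) ∧
    (∀ (ρ : ℝ → ℝ) (Δ : ℝ) (S : CorrFamily 3), (∀ δ ∈ Set.Ioc (0:ℝ) 1, 0 < ρ δ) →
      HasPointwiseScalingLimit (criticalCorr 3) ρ S →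
      (∀ n z, z ∉ NonCoincident 3 n → S n z = 0) → IsNondegenerateTwoPoint S →
      IsEuclideanInvariant S → IsScaleCovariant Δ S →
      ∀ n : ℕ, Even n → 4 ≤ n →
        ∀ x : Fin (n + 2) → EuclideanSpace ℝ (Fin 3), x ∈ NonCoincident 3 (n + 2) →
          (∀ i, x i ≠ 0) → (∀ i, ‖x i‖ < 1) →
          ∀ ε : ℝ, 0 < ε → ∀ᶠ δ in 𝓝[>] (0:ℝ),
          criticalCorr 3 n (fun i => latticeApprox δ (x (Fin.castAdd 2 i))) *
              criticalCorr 3 2 (fun i => latticeApprox δ (x (Fin.natAdd n i))) /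
            criticalCorr 3 (n + 2) (fun i => latticeApprox δ (x i)) ≤
          criticalCorr 3 n (fun i => latticeApprox δ (inversion 0 1 (x (Fin.castAdd 2 i)))) *
              criticalCorr 3 2 (fun i => latticeApprox δ (inversion 0 1 (x (Fin.natAdd n i)))) /
            criticalCorr 3 (n + 2) (fun i => latticeApprox δ (inversion 0 1 (x i))) + ε) := by
  refine ⟨?_, ?_⟩
  · intro ρ Δ S hρ hlim hnorm hnd heuc hsc x hx hx0 _ ε hε
    exact eventually_le_add_of_isInversionCovariant hρ hlim hnd
      (hcrux ρ Δ S hρ hlim hnorm hnd heuc hsc) even_two hx hx0 hε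
  · intro ρ Δ S hρ hlim hnorm hnd heuc hsc n hn _ x hx hx0 _ ε hε
    exact eventually_le_add_of_isInversionCovariant hρ hlim hnd
      (hcrux ρ Δ S hρ hlim hnorm hnd heuc hsc) hn hx hx0 hε

/-- **C ∧ D ⇔ crux** (the two open registered stubs of line `inversion-defect-involution` are
together EQUIVALENT to `InversionUpgradeNormalised`). [folklore] -/
theorem InversionUpgradeNormalised_iff_latticeOneSided :
    Summit.CriticalPhenomena.Ising3DConformalLimit.Theses.HyperoctahedralRP.InversionUpgradeNormalised ↔
    ((∀ (ρ : ℝ → ℝ) (Δ : ℝ) (S : CorrFamily 3), (∀ δ ∈ Set.Ioc (0:ℝ) 1, 0 < ρ δ) →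
      HasPointwiseScalingLimit (criticalCorr 3) ρ S →
      (∀ n z, z ∉ NonCoincident 3 n → S n z = 0) → IsNondegenerateTwoPoint S →
      IsEuclideanInvariant S → IsScaleCovariant Δ S →
      ∀ x : Fin (2 + 2) → EuclideanSpace ℝ (Fin 3), x ∈ NonCoincident 3 (2 + 2) →
        (∀ i, x i ≠ 0) → (∀ i, ‖x i‖ < 1) →
        ∀ ε : ℝ, 0 < ε → ∀ᶠ δ in 𝓝[>] (0:ℝ),
          criticalCorr 3 2 (fun i => latticeApprox δ (x (Fin.castAdd 2 i))) *
              criticalCorr 3 2 (fun i => latticeApprox δ (x (Fin.natAdd 2 i))) /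
            criticalCorr 3 (2 + 2) (fun i => latticeApprox δ (x i)) ≤
          criticalCorr 3 2 (fun i => latticeApprox δ (inversion 0 1 (x (Fin.castAdd 2 i)))) *
              criticalCorr 3 2 (fun i => latticeApprox δ (inversion 0 1 (x (Fin.natAdd 2 i)))) /
            criticalCorr 3 (2 + 2) (fun i => latticeApprox δ (inversion 0 1 (x i))) + ε) ∧
    (∀ (ρ : ℝ → ℝ) (Δ : ℝ) (S : CorrFamily 3), (∀ δ ∈ Set.Ioc (0:ℝ) 1, 0 < ρ δ) →
      HasPointwiseScalingLimit (criticalCorr 3) ρ S →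
      (∀ n z, z ∉ NonCoincident 3 n → S n z = 0) → IsNondegenerateTwoPoint S →
      IsEuclideanInvariant S → IsScaleCovariant Δ S →
      ∀ n : ℕ, Even n → 4 ≤ n →
        ∀ x : Fin (n + 2) → EuclideanSpace ℝ (Fin 3), x ∈ NonCoincident 3 (n + 2) →
          (∀ i, x i ≠ 0) → (∀ i, ‖x i‖ < 1) →
          ∀ ε : ℝ, 0 < ε → ∀ᶠ δ in 𝓝[>] (0:ℝ),
          criticalCorr 3 n (fun i => latticeApprox δ (x (Fin.castAdd 2 i))) *
              criticalCorr 3 2 (fun i => latticeApprox δ (x (Fin.natAdd n i))) /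
            criticalCorr 3 (n + 2) (fun i => latticeApprox δ (x i)) ≤
          criticalCorr 3 n (fun i => latticeApprox δ (inversion 0 1 (x (Fin.castAdd 2 i)))) *
              criticalCorr 3 2 (fun i => latticeApprox δ (inversion 0 1 (x (Fin.natAdd n i)))) /
            criticalCorr 3 (n + 2) (fun i => latticeApprox δ (inversion 0 1 (x i))) + ε)) :=
  ⟨latticeOneSided_of_InversionUpgradeNormalised, fun h => InversionUpgradeNormalised_of_latticeOneSided h.1 h.2⟩


/-! ### The automatic locus of the open stubs: configurations cospherical about the origin -/

/-- **C and D hold NOW on the cospherical-about-`0` locus.**  If all points of a non-coincident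
configuration `x` have the same norm `r > 0`, then `ι x = r⁻² • x` is a DILATE of `x`, the limit
ratio `R_S = S_n S_2 / S_{n+2}` takes the same value at `x` and at `ι x` by scale covariance alone
(the weights `c^{-nΔ} c^{-2Δ} = c^{-(n+2)Δ}` cancel), and both lattice ratios converge to it
(`tendsto_latticeRatio`); hence `R^δ_n(x) ≤ R^δ_n(ιx) + ε` eventually.  This isolates the CONTENT of
the open stubs C, D: it lies entirely in configurations whose inverse is not similar to them (for
four points, the three shape parameters beyond the two cross-ratios). [folklore] -/
theorem eventually_le_add_of_norm_eq {ρ : ℝ → ℝ} {Δ : ℝ} {S : CorrFamily 3}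
    (hρ : ∀ δ ∈ Set.Ioc (0:ℝ) 1, 0 < ρ δ) (hlim : HasPointwiseScalingLimit (criticalCorr 3) ρ S)
    (hnd : IsNondegenerateTwoPoint S) (hsc : IsScaleCovariant Δ S)
    {n : ℕ} (hn : Even n) {x : Fin (n + 2) → EuclideanSpace ℝ (Fin 3)}
    (hx : x ∈ NonCoincident 3 (n + 2)) {r : ℝ} (hr0 : 0 < r) (hr : ∀ i, ‖x i‖ = r)
    {ε : ℝ} (hε : 0 < ε) :
    ∀ᶠ δ in 𝓝[>] (0:ℝ),
      criticalCorr 3 n (fun i => latticeApprox δ (x (Fin.castAdd 2 i))) *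
            criticalCorr 3 2 (fun i => latticeApprox δ (x (Fin.natAdd n i))) /
          criticalCorr 3 (n + 2) (fun i => latticeApprox δ (x i)) ≤
        criticalCorr 3 n (fun i => latticeApprox δ (inversion 0 1 (x (Fin.castAdd 2 i)))) *
            criticalCorr 3 2 (fun i => latticeApprox δ (inversion 0 1 (x (Fin.natAdd n i)))) /
          criticalCorr 3 (n + 2) (fun i => latticeApprox δ (inversion 0 1 (x i))) + ε := by
  set c : ℝ := (1 / r) ^ 2 with hc
  have hcpos : 0 < c := by positivity
  have hι : ∀ y : EuclideanSpace ℝ (Fin 3), ‖y‖ = r →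
      inversion (0 : EuclideanSpace ℝ (Fin 3)) 1 y = c • y := fun y hy => by rw [inv_eq, hy]
  have hpos := stub_evenPos ρ S hρ hlim hnd
  have hn2 : Even (n + 2) := by simpa [Nat.even_add] using hn
  have hιx : (fun i => inversion (0 : EuclideanSpace ℝ (Fin 3)) 1 (x i)) ∈ NonCoincident 3 (n + 2) :=
    injective_inv_comp hx
  have hSx : S (n + 2) x ≠ 0 := (hpos _ hn2 x hx).ne'
  have hSιx : S (n + 2) (fun i => inversion 0 1 (x i)) ≠ 0 := (hpos _ hn2 _ hιx).ne'
  have h1 := tendsto_latticeRatio hρ hlim hx hSx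
  have h2 := tendsto_latticeRatio hρ hlim hιx hSιx
  have key : S n (fun i => inversion 0 1 (x (Fin.castAdd 2 i))) *
        S 2 (fun i => inversion 0 1 (x (Fin.natAdd n i))) / S (n + 2) (fun i => inversion 0 1 (x i)) =
      S n (fun i => x (Fin.castAdd 2 i)) * S 2 (fun i => x (Fin.natAdd n i)) / S (n + 2) x := by
    have f1 : (fun i => inversion (0 : EuclideanSpace ℝ (Fin 3)) 1 (x (Fin.castAdd 2 i))) =
        fun i => c • x (Fin.castAdd 2 i) := funext fun i => hι _ (hr _)
    have f2 : (fun i => inversion (0 : EuclideanSpace ℝ (Fin 3)) 1 (x (Fin.natAdd n i))) =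
        fun i => c • x (Fin.natAdd n i) := funext fun i => hι _ (hr _)
    have f3 : (fun i => inversion (0 : EuclideanSpace ℝ (Fin 3)) 1 (x i)) = fun i => c • x i :=
      funext fun i => hι _ (hr _)
    have s1 := hsc n c hcpos (fun i => x (Fin.castAdd 2 i))
    have s2 := hsc 2 c hcpos (fun i => x (Fin.natAdd n i))
    have s3 := hsc (n + 2) c hcpos x
    beta_reduce at s1 s2
    have hexp : c ^ (-(n : ℝ) * Δ) * c ^ (-((2 : ℕ) : ℝ) * Δ) = c ^ (-((n + 2 : ℕ) : ℝ) * Δ) := by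
      rw [← Real.rpow_add hcpos]; congr 1; push_cast; ring
    rw [f1, f2, f3, s1, s2, s3, mul_mul_mul_comm, hexp,
      mul_div_mul_left _ _ (Real.rpow_pos_of_pos hcpos _).ne']
  have h3 := h2.sub h1
  rw [key, sub_self] at h3
  exact eventually_le_add_of_tendsto_sub_nhds_zero _ _ h3 hε

end Summit.CriticalPhenomena.Ising3DConformalLimit.Cruxes.InversionUpgradeNormalised.InversionDefectInvolution

end
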